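import Mathlib
import Summits.Ventures.PercRepro2.TB14Hall
import Summits.Ventures.PercRepro2.TB14Profile

/-!
# Row 2′TB (typed BHK 1.4 single-vertex): THE TERRITORY-FIBRE MECHANISM AS A NAMED PROP —
`TerritoryDom` — and `TB14` from it (blind cell PercRepro2, p5 g6, 2026-08-25; proofs/P5-FIBRE.md
§1–§2, §7–§8; S4 v35 §2.4 (h))

Decompose a configuration `y` by the TERRITORY of `a₂` — `territory = C₁(a₂) ∪ C₂(a₂)`, its first-
and second-copy clusters. Under `Q` (`a₁ ∉ territory`) the first-copy cluster of `a₁` lives outside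
the first-copy cluster `C₁(a₂)`: it moves along first-copy-open edges off the territory and along
the first-copy-open edges of the BLUE-ONLY part `B = C₂(a₂) ∖ C₁(a₂)` (the «B-graph» `bGraph`:
first-copy-open edges with one end in `B` and the other end outside `C₁(a₂)`). Hence `b ∈ C₁(a₁)`
is an INCREASING function of `bGraph y` once the edges off the territory are frozen
(`conn_a1_of_bGraph_subset`, the lifting lemma).

* `TerritoryDom`: on every finite graph, marks and the all-free profile, there is an injection `M`
  of the sources (`srcSet`) into configurations that keeps the territory of `a₂`, agrees with the
  source off the edges touching that territory, puts `o` into the blue-only part, and enlarges the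
  B-graph — the form in which the fibre-wise Γ_B-monotone perfect matchings of (DOM) (P5-FIBRE.md
  §2) lift to configurations, `(ζ, η) ↦ (M_U ζ, η)`. Census-true on every connected graph with
  `n ≤ 6` vertices (all `m`, all markings; (DOM) for `m ≤ 9` at `n = 6`), unproved;
* `tb14_allFree_of_territoryDom`: it gives the (TB14) inequality at the all-free profile
  (`TB14Hall.tb14_of_injOn` with the lifting lemma);
* **`tb14_of_territoryDom : TerritoryDom → TB14 R`**: the named conditional Prop
  `A3InactiveTyped.TB14` at every profile (mine-c's `TB14Cut.TB14_of_allFree`).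

A conditional bridge, no proof of the row; standard axioms.
-/

namespace Summit.Ventures.PercRepro2

namespace TB14Territory

open CovForm A3InactiveTyped TB14Fold TB14FlipFamily TB14Hall

section Defs

variable {V : Type} {E : Type} [DecidableEq E]
variable (ends : E → Sym2 V) (a₂ : V) (F : Finset E)

/-- **The territory of `a₂`**: the union of its first- and second-copy clusters. -/
def territory (y : Config E) : Set V :=
  cluster ends y a₂ ∪ cluster ends (A3InactiveTyped.flipOn F y) a₂

/-- **The blue-only part `B`**: the second-copy cluster of `a₂` minus its first-copy cluster. -/
def bOnly (y : Config E) : Set V :=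
  cluster ends (A3InactiveTyped.flipOn F y) a₂ \ cluster ends y a₂

/-- **The B-graph `Γ_B`**: the first-copy-open edges with one end in `B` and the other end outside
the first-copy cluster of `a₂` (inside `B`, or leaving the territory). -/
def bGraph (y : Config E) : Set E :=
  {e | y e = true ∧ ∃ x w, ends e = s(x, w) ∧ x ∈ bOnly ends a₂ F y ∧ w ∉ cluster ends y a₂}

/-- A vertex of the territory outside the first-copy cluster of `a₂` is in `B`. -/
lemma mem_bOnly_of_mem_territory {y : Config E} {x : V} (hx : x ∈ territory ends a₂ F y)
    (hx' : x ∉ cluster ends y a₂) : x ∈ bOnly ends a₂ F y := by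
  rcases hx with h | h
  · exact absurd h hx'
  · exact ⟨h, hx'⟩

/-- **The lifting lemma.** If `y'` agrees with `y` off the edges touching the territory of `a₂`
in `y`, and `Γ_B(y) ⊆ Γ_B(y')`, then every vertex first-copy-joined to `a₁` in `y` is so in `y'`,
provided `a₁` is not first-copy-joined to `a₂` in `y`. -/
lemma conn_a1_of_bGraph_subset {y y' : Config E} (a₁ : V) (hQ : ¬ Conn ends y a₁ a₂)
    (hout : ∀ e, e ∉ touches ends (territory ends a₂ F y) → y' e = y e)
    (hB : bGraph ends a₂ F y ⊆ bGraph ends a₂ F y') {v : V} (hv : Conn ends y a₁ v) :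
    Conn ends y' a₁ v := by
  have key : v ∈ {u | Conn ends y' a₁ u ∧ ¬ Conn ends y a₂ u} := by
    refine mem_of_conn_of_closed (ends := ends) (ω := y) ?_
      ⟨conn_refl ends y' a₁, fun h => hQ (conn_symm h)⟩ hv
    intro x hx w hxw
    obtain ⟨hx1, hx2⟩ := hx
    rw [openGraph_adj] at hxw
    obtain ⟨_, e, he, hends⟩ := hxw
    have hw2 : ¬ Conn ends y a₂ w := fun h =>
      hx2 (conn_trans h (conn_symm (conn_of_openAdj ⟨e, he, hends⟩)))
    have he' : y' e = true := by
      by_cases hxin : x ∈ territory ends a₂ F y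
      · have hxB := mem_bOnly_of_mem_territory ends a₂ F hxin hx2
        exact (hB ⟨he, x, w, hends, hxB, hw2⟩).1
      · by_cases hwin : w ∈ territory ends a₂ F y
        · have hwB := mem_bOnly_of_mem_territory ends a₂ F hwin hw2
          exact (hB ⟨he, w, x, by rw [hends, Sym2.eq_swap], hwB, hx2⟩).1
        · have hnt : e ∉ touches ends (territory ends a₂ F y) := by
            rintro ⟨p, hp, q, hpq⟩
            rw [hends, Sym2.eq_iff] at hpq
            rcases hpq with ⟨rfl, _⟩ | ⟨_, rfl⟩
            · exact hxin hp
            · exact hwin hp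
          rw [hout e hnt]
          exact he
    exact ⟨conn_trans hx1 (conn_of_openAdj ⟨e, he', hends⟩), hw2⟩
  exact key.1

end Defs

section Statement

/-- **THE TERRITORY-FIBRE STATEMENT OF THE (TB14) LINE AS A NAMED PROP** (P5-FIBRE.md §2, (DOM) lifted
to configurations): on every finite graph, for every choice of the marks, at the all-free profile,
there is an injection `M` of the sources into configurations which keeps the territory of `a₂`,
agrees with the source off the edges touching that territory, puts `o` into the blue-only part and
enlarges the B-graph. Census-true on every connected graph with `n ≤ 6` vertices (all `m`, all
markings; the matching for `m ≤ 9` at `n = 6`); unproved. -/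
def TerritoryDom : Prop :=
  ∀ (V E : Type) [Fintype E] [DecidableEq E] (ends : E → Sym2 V) (a₁ a₂ b o : V),
    ∃ M : Config E → Config E,
      Set.InjOn M (srcSet ends a₁ a₂ b o Finset.univ (fun _ => false) : Set (Config E)) ∧
      ∀ y ∈ srcSet ends a₁ a₂ b o Finset.univ (fun _ => false),
        territory ends a₂ Finset.univ (M y) = territory ends a₂ Finset.univ y ∧
        (∀ e, e ∉ touches ends (territory ends a₂ Finset.univ y) → M y e = y e) ∧
        o ∈ bOnly ends a₂ Finset.univ (M y) ∧
        bGraph ends a₂ Finset.univ y ⊆ bGraph ends a₂ Finset.univ (M y)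

variable {R : Type*} [Field R] [LinearOrder R] [IsStrictOrderedRing R]

/-- `TerritoryDom` gives the (TB14) inequality at the all-free profile on every finite graph. -/
theorem tb14_allFree_of_territoryDom (h : TerritoryDom) (V E : Type) [Fintype E] [DecidableEq E]
    (ends : E → Sym2 V) (a₁ a₂ b o : V) :
    pairCount Finset.univ (fun _ => false) (sameBO ends a₁ a₂ b o : Config E → Config E → R) ≤
      pairCount Finset.univ (fun _ => false) (crossBO ends a₁ a₂ b o) := by
  classical
  obtain ⟨M, hinj, hM⟩ := h V E ends a₁ a₂ b o
  refine tb14_of_injOn ends a₁ a₂ b o Finset.univ (fun _ => false) M ?_ hinj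
  intro y hy
  obtain ⟨hterr, hout, ho, hB⟩ := hM y hy
  have hy' : IsSrc ends a₁ a₂ b o Finset.univ y := by
    unfold srcSet at hy
    exact (Finset.mem_filter.1 hy).2.2
  have ha₁ : a₁ ∉ territory ends a₂ Finset.univ y := by
    rintro (h1 | h2)
    · exact hy'.q₁ (conn_symm h1)
    · exact hy'.q₂ (conn_symm h2)
  unfold tgtSet
  refine Finset.mem_filter.2 ⟨Finset.mem_univ _, fun e he => absurd (Finset.mem_univ e) he, ?_⟩
  refine ⟨?_, ?_, ?_, ho.1, ho.2⟩
  · intro hc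
    exact ha₁ (hterr ▸ Or.inl (conn_symm hc))
  · intro hc
    exact ha₁ (hterr ▸ Or.inr (conn_symm hc))
  · exact conn_a1_of_bGraph_subset ends a₂ Finset.univ a₁ hy'.q₁ hout hB hy'.hb

/-- **`TerritoryDom → TB14 R`**: the territory-fibre statement implies the named conditional Prop of
row 2′TB at every profile (through mine-c's `TB14Cut.TB14_of_allFree`). -/
theorem tb14_of_territoryDom (h : TerritoryDom) : TB14 R :=
  TB14Cut.TB14_of_allFree R fun V E _ _ ends a₁ a₂ b o =>
    tb14_allFree_of_territoryDom (R := R) h V E ends a₁ a₂ b o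

end Statement

end TB14Territory

end Summit.Ventures.PercRepro2
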